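import Mathlib.Analysis.SpecialFunctions.Log.Basic
import Mathlib.Analysis.SpecialFunctions.Pow.Real
import Literature.Analysis.FluidPDE.PineauVicolRSS
import Literature.Analysis.FluidPDE.ChaeWolfRemovingDSS
import Literature.Analysis.FluidPDE.ClassicalSolutionRescale
import Literature.Analysis.FluidPDE.ClassicalSolutionGlue
import HarnessLib

/-!
# Pineau–Vicol 2026, Theorem 1.4 — proofs, I: the large-`|α|` half from Chae–Wolf 2017

Analysis/FluidPDE proof file, companion of the named-fact file `PineauVicolRSS.lean`
(`pineauVicol2026_rss_liouville` = B. Pineau, V. Vicol, arXiv:2607.09619 (2026), **Theorem 1.4**: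
Type I rotated self-similar (RSS) solutions of 3D Navier–Stokes with rotation speed `|α| ≪ 1` or
`|α| ≫ 1` are trivial). All results here are PROVED; no new named fact is introduced.

What is proved (following the paper's own remark, p. 6 of the text: "In light of Remark 1.5 …
it is worth noting that [12] (= Chae–Wolf 2017, Thm. 1.3) gives an *alternative proof* of the
large `|α|` case in Theorem 1.4"):

* `rotZ_add_two_pi'`, `rotZ_sub_two_pi'`: `R(θ ± 2π) = R(θ)` ((1.6); Remark 1.5 "R(s + 2π) = R(s)").
* `pvAnsatz_rss_nsRescale`: **Remark 1.5 (RSS ⊆ DSS)** — if `α · 2 log c ∈ {±2π}` (i.e.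
  `c = e^{π/|α|}`), the RSS ansatz field (1.7) is `c`-discretely self-similar,
  `c u(c²t, cx) = u(t, x)`.
* `IsClassicalNSSolutionOn.exists_pressure_Iio_of_Ioo`: a velocity field which is a classical
  solution on every `(a_k, 0)` (with some pressure `q_k`), `a_k` exhausting `(−∞, 0)`, is a
  classical solution on `(−∞, 0)` with ONE (normalised) pressure — the bookkeeping behind
  footnote 13 of the paper ("the ansatz (1.7) allows us to extend it backwards-in-time as a solution
  of Navier–Stokes on `ℝ³ × [−T, 0)` for any `T ≥ 1`"), via the scaling covariance
  `IsClassicalNSSolutionOn.nsRescale_holds` and the pressure normalisation of `ClassicalSolutionGlue`.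
* `norm_pvAnsatz_le_of_profile`: **Remark 1.2** — the profile bound (1.9)
  `|U(y)| ≤ C/(1+|y|)` gives the Type I bound (1.10) for the ansatz field at every `t < 0`.
* `pineauVicol2026_rss_liouville_large_of_chaeWolf`: **the large-`|α|` half of Theorem 1.4,
  conditional on the named fact `chaeWolf2017_removing_dss`** (Chae–Wolf 2017, Thm. 1.3, vendored
  unproved in `ChaeWolfRemovingDSS.lean`): for every `C₀ > 0` there is `α₂ = π / log λ_*(C₀) > 0`
  such that Type I classical RSS solutions on `[−1, 0)` with `|α| > α₂` have `U ≡ 0`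
  (with `λ = e^{π/|α|} ∈ (1, λ_*)`).
* `pineauVicol2026_rss_liouville_of_chaeWolf_of_small`: the assembly — Theorem 1.4 follows from
  `chaeWolf2017_removing_dss` and its small-`|α|` half (the paper's §5, the genuinely new part,
  NOT proved in the tree; written out as an explicit hypothesis, not as a named fact).

## References

* B. Pineau, V. Vicol, arXiv:2607.09619 (2026): (1.6)–(1.10), Remarks 1.2, 1.3, 1.5, Theorem 1.4,
  §2 footnote 13. [PineauVicol2026]
* D. Chae, J. Wolf, Comm. PDE 42 (2017) 1359–1374 = arXiv:1610.09464, Thm. 1.3. [ChaeWolf2017RemovingDSS]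
* J. Leray, Acta Math. 63 (1934), §20 (similarity transformation). [Leray1934]
-/

noncomputable section

open Set Filter Function
open scoped Topology

namespace Literature.Analysis.FluidPDE


/-! ### Periodicity of the rotations about the axis -/

/-- `R(θ + 2π) = R(θ)` for the rotation about the `e₃`-axis (Pineau–Vicol 2026, Remark 1.5:
"`R(s + 2π) = R(s)`"). (A copy of `rotZ_two_pi`-type bookkeeping with a light import.) [cite: PineauVicol2026, Remark 1.5 (arXiv:2607.09619 p. 5)] -/
theorem rotZ_add_two_pi' (θ : ℝ) (x : EuclideanSpace ℝ (Fin 3)) :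
    rotZ (θ + 2 * Real.pi) x = rotZ θ x := by
  ext i
  fin_cases i <;> simp [Real.cos_add_two_pi, Real.sin_add_two_pi]

/-- `R(θ − 2π) = R(θ)` for the rotation about the `e₃`-axis (Pineau–Vicol 2026, Remark 1.5). [cite: PineauVicol2026, Remark 1.5 (arXiv:2607.09619 p. 5)] -/
theorem rotZ_sub_two_pi' (θ : ℝ) (x : EuclideanSpace ℝ (Fin 3)) :
    rotZ (θ - 2 * Real.pi) x = rotZ θ x := by
  ext i
  fin_cases i <;> simp [Real.cos_sub_two_pi, Real.sin_sub_two_pi]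

/-- If `φ = ±2π` (the case `φ = α · 2 log c` with `c = e^{π/|α|}`, `α ≠ 0`), then `R(θ + φ) = R(θ)`
for all `θ` (Pineau–Vicol 2026, Remark 1.5: `2α log λ ∈ 2πℤ`). [cite: PineauVicol2026, Remark 1.5 (arXiv:2607.09619 p. 5)] -/
theorem rotZ_add_eq_self_of_exp_pi_div_abs {α : ℝ} (hα : α ≠ 0) (θ : ℝ)
    (x : EuclideanSpace ℝ (Fin 3)) :
    rotZ (θ + α * (2 * Real.log (Real.exp (Real.pi / |α|)))) x = rotZ θ x := by
  rw [Real.log_exp]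
  rcases lt_or_gt_of_ne hα with hneg | hpos
  · rw [abs_of_neg hneg,
      show θ + α * (2 * (Real.pi / -α)) = θ - 2 * Real.pi by field_simp; ring]
    exact rotZ_sub_two_pi' θ x
  · rw [abs_of_pos hpos, show θ + α * (2 * (Real.pi / α)) = θ + 2 * Real.pi by field_simp]
    exact rotZ_add_two_pi' θ x

/-! ### Remark 1.5: the RSS ansatz field is discretely self-similar with factor `e^{π/|α|}` -/

/-- For `t ≥ 0` the ansatz field takes the junk value `0` (`√(−t) = 0`). [cite: PineauVicol2026, (1.7) (arXiv:2607.09619 p. 3)] -/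
theorem pvAnsatz_of_nonneg (α : ℝ)
    (V : EuclideanSpace ℝ (Fin 3) → ℝ → EuclideanSpace ℝ (Fin 3)) {t : ℝ}
    (ht : 0 ≤ t) (x : EuclideanSpace ℝ (Fin 3)) :
    pvAnsatz α V t x = 0 := by
  have h : Real.sqrt (-t) = 0 := Real.sqrt_eq_zero'.mpr (by linarith)
  simp [pvAnsatz, h]

/-- **Remark 1.5 (RSS ⊆ DSS), scaling identity.** If the rotations satisfy `R(θ + α·2 log c) = R(θ)`
(e.g. `c = e^{π/|α|}`), then for `t < 0` the RSS ansatz field `u` of (1.7) with time-independent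
profile `U` satisfies `c u(c²t, cx) = u(t, x)`: indeed `s(c²t) = s(t) − 2 log c`,
`√(−c²t) = c√(−t)`. [cite: PineauVicol2026, Remark 1.5 (arXiv:2607.09619 pp. 5–6)] -/
theorem pvAnsatz_rss_nsRescale {α c : ℝ} (hc : 0 < c)
    (hφ : ∀ (θ : ℝ) (v : EuclideanSpace ℝ (Fin 3)),
      rotZ (θ + α * (2 * Real.log c)) v = rotZ θ v)
    (U : EuclideanSpace ℝ (Fin 3) → EuclideanSpace ℝ (Fin 3)) {t : ℝ} (ht : t < 0)
    (x : EuclideanSpace ℝ (Fin 3)) :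
    c • pvAnsatz α (fun y _ => U y) (c ^ 2 * t) (c • x) =
      pvAnsatz α (fun y _ => U y) t x := by
  have hnt : 0 < -t := by linarith
  have hs : 0 < Real.sqrt (-t) := Real.sqrt_pos.2 hnt
  have hsqrt : Real.sqrt (-(c ^ 2 * t)) = c * Real.sqrt (-t) := by
    rw [show -(c ^ 2 * t) = c ^ 2 * (-t) by ring, Real.sqrt_mul (sq_nonneg c), Real.sqrt_sq hc.le]
  have hlog : Real.log (-(c ^ 2 * t)) = 2 * Real.log c + Real.log (-t) := by
    rw [show -(c ^ 2 * t) = c ^ 2 * (-t) by ring, Real.log_mul (by positivity) hnt.ne',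
      Real.log_pow]
    push_cast
    ring
  have h1 : ∀ v : EuclideanSpace ℝ (Fin 3),
      rotZ (α * -(2 * Real.log c + Real.log (-t))) v = rotZ (α * -Real.log (-t)) v := by
    intro v
    have h := hφ (α * -(2 * Real.log c + Real.log (-t))) v
    rw [show α * -(2 * Real.log c + Real.log (-t)) + α * (2 * Real.log c) = α * -Real.log (-t) by
      ring] at h
    exact h.symm
  have h2 : ∀ v : EuclideanSpace ℝ (Fin 3), rotZ (-(α * -(2 * Real.log c + Real.log (-t)))) v =
      rotZ (-(α * -Real.log (-t))) v := by
    intro v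
    have h := hφ (-(α * -Real.log (-t))) v
    rw [show -(α * -Real.log (-t)) + α * (2 * Real.log c) =
      -(α * -(2 * Real.log c + Real.log (-t))) by ring] at h
    exact h
  simp only [pvAnsatz]
  rw [hsqrt, hlog, h1, h2]
  have h3 : (c * Real.sqrt (-t))⁻¹ • (c • x) = (Real.sqrt (-t))⁻¹ • x := by
    rw [smul_smul]
    congr 1
    field_simp
  rw [h3, smul_smul]
  congr 1
  field_simp

/-- **Remark 1.5 (RSS ⊆ DSS).** Under `R(θ + α·2 log c) = R(θ)`, `0 < c`, the RSS ansatz field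
(extended by `0` for `t ≥ 0`, its junk value) is `c`-discretely self-similar in the sense of
`IsDiscretelySelfSimilar` (`c u(c²t, cx) = u(t,x)` for all `t`, `x`). [cite: PineauVicol2026, Remark 1.5 (arXiv:2607.09619 pp. 5–6)] -/
theorem isDiscretelySelfSimilar_pvAnsatz {α c : ℝ} (hc : 0 < c)
    (hφ : ∀ (θ : ℝ) (v : EuclideanSpace ℝ (Fin 3)),
      rotZ (θ + α * (2 * Real.log c)) v = rotZ θ v)
    (U : EuclideanSpace ℝ (Fin 3) → EuclideanSpace ℝ (Fin 3)) :
    IsDiscretelySelfSimilar c (pvAnsatz α (fun y _ => U y)) := by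
  show nsRescale c (pvAnsatz α (fun y _ => U y)) = pvAnsatz α (fun y _ => U y)
  funext t x
  rw [nsRescale_apply]
  by_cases ht : t < 0
  · exact pvAnsatz_rss_nsRescale hc hφ U ht x
  · have ht' : 0 ≤ t := not_lt.1 ht
    rw [pvAnsatz_of_nonneg _ _ (mul_nonneg (sq_nonneg c) ht'), pvAnsatz_of_nonneg _ _ ht',
      smul_zero]

/-- Discrete self-similarity with factor `c ≠ 0` gives it with every factor `(c^k)⁻¹`, `k ∈ ℕ`
(group law of the parabolic rescaling). [folklore] -/
theorem IsDiscretelySelfSimilar.inv_pow {E F : Type*} [NormedAddCommGroup E] [NormedSpace ℝ E]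
    [NormedAddCommGroup F] [NormedSpace ℝ F] {c : ℝ} {v : ℝ → E → F} (hc : c ≠ 0)
    (h : IsDiscretelySelfSimilar c v) (k : ℕ) : IsDiscretelySelfSimilar ((c ^ k)⁻¹) v := by
  have hk : nsRescale (c ^ k) v = v := by
    induction k with
    | zero => simp
    | succ n ih => rw [pow_succ, nsRescale_mul, ih]; exact h
  show nsRescale (c ^ k)⁻¹ v = v
  calc nsRescale (c ^ k)⁻¹ v = nsRescale (c ^ k)⁻¹ (nsRescale (c ^ k) v) := by rw [hk]
    _ = v := nsRescale_inv_nsRescale (pow_ne_zero _ hc) v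

/-! ### Footnote 13: extension backwards in time as a classical solution on `(−∞, 0)` -/

section Exhaustion

variable {E : Type*} [NormedAddCommGroup E] [InnerProductSpace ℝ E] [FiniteDimensional ℝ E]

/-- A classical solution stays classical when the velocity is replaced by a field with the same
slices on the time set (all clauses only see `u t`, `t ∈ S`, and the time derivative within `S`).
(Private copy of the tree's `IsClassicalNSSolutionOn.congr_velocity`, kept here to avoid a heavy
import.) [folklore] -/
private theorem isClassicalNSSolutionOn_congr_velocity {S : Set ℝ} {ν : ℝ}
    {f u v : ℝ → E → E} {p : ℝ → E → ℝ} (h : IsClassicalNSSolutionOn S ν f u p)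
    (huv : ∀ t ∈ S, v t = u t) :
    IsClassicalNSSolutionOn S ν f v p where
  smooth_velocity :=
    h.smooth_velocity.congr fun z hz => by
      change v z.1 z.2 = u z.1 z.2
      rw [huv z.1 (mem_prod.1 hz).1]
  smooth_pressure := h.smooth_pressure
  momentum t ht x := by
    have h1 : timeDerivWithin S v t x = timeDerivWithin S u t x := by
      simp only [timeDerivWithin]
      exact derivWithin_congr (fun s hs => by rw [huv s hs]) (by rw [huv t ht])
    rw [h1, huv t ht]
    exact h.momentum t ht x
  divFree t ht := by
    rw [huv t ht]
    exact h.divFree t ht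

/-- **One pressure on `(−∞, 0)` from pressures on an exhausting family of intervals.** If the
same velocity field `v` is, for every `k`, a classical solution on `(a_k, 0)` with some pressure
`q_k` (same viscosity and force), and every `t < 0` lies in some `(a_k, 0)`, then `v` is a
classical solution on `(−∞, 0)` with a single pressure: the momentum equations force
`∇q_j = ∇q_k` on overlaps (`pressure_sub_apply_zero_eq_of_eventuallyEq`), so the normalised
pressures `q_k(t,x) − q_k(t,0)` patch to one jointly smooth field (smoothness is local,
`contDiffOn_of_locally_contDiffOn`). [folklore] -/
theorem IsClassicalNSSolutionOn.exists_pressure_Iio_of_Ioo {ν : ℝ} {f v : ℝ → E → E}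
    {a : ℕ → ℝ} {q : ℕ → ℝ → E → ℝ}
    (hsol : ∀ k, IsClassicalNSSolutionOn (Ioo (a k) 0) ν f v (q k))
    (hexh : ∀ t < 0, ∃ k, a k < t) :
    ∃ P : ℝ → E → ℝ, IsClassicalNSSolutionOn (Iio 0) ν f v P := by
  choose! K hK using hexh
  have hagree : ∀ (j k : ℕ) (t : ℝ), a j < t → a k < t → t < 0 → ∀ x : E,
      q j t x - q j t 0 = q k t x - q k t 0 :=
    fun j k t hj hk ht x => (hsol j).pressure_sub_apply_zero_eq_of_eventuallyEq (hsol k)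
      (Ioo_mem_nhds hj ht) (Ioo_mem_nhds hk ht) (Eventually.of_forall fun _ => rfl) x
  have hset : ∀ b : ℝ,
      (Iio (0 : ℝ) ×ˢ (univ : Set E)) ∩ Ioi b ×ˢ univ = Ioo b 0 ×ˢ univ := by
    intro b
    rw [prod_inter_prod, Iio_inter_Ioi, inter_self]
  refine ⟨fun t x => q (K t) t x - q (K t) t 0, ?_, ?_, ?_, ?_⟩
  · refine contDiffOn_of_locally_contDiffOn fun z hz => ?_
    obtain ⟨t, x⟩ := z
    have ht : t < 0 := hz.1
    refine ⟨Ioi (a (K t)) ×ˢ univ, isOpen_Ioi.prod isOpen_univ, ⟨hK t ht, mem_univ _⟩, ?_⟩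
    rw [hset]
    exact (hsol (K t)).smooth_velocity
  · refine contDiffOn_of_locally_contDiffOn fun z hz => ?_
    obtain ⟨t, x⟩ := z
    have ht : t < 0 := hz.1
    refine ⟨Ioi (a (K t)) ×ˢ univ, isOpen_Ioi.prod isOpen_univ, ⟨hK t ht, mem_univ _⟩, ?_⟩
    rw [hset]
    refine (hsol (K t)).smooth_pressure.sub_apply_zero.congr fun z hz => ?_
    obtain ⟨τ, y⟩ := z
    have hτ : τ ∈ Ioo (a (K t)) 0 := hz.1
    simp only [uncurry_apply_pair]
    exact hagree (K τ) (K t) τ (hK τ hτ.2) hτ.1 hτ.2 y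
  · intro t ht x
    have ht' : t < 0 := ht
    have hD : timeDerivWithin (Iio 0) v t x = timeDerivWithin (Ioo (a (K t)) 0) v t x := by
      simp only [timeDerivWithin_apply]
      rw [derivWithin_of_mem_nhds (Iio_mem_nhds ht'),
        derivWithin_of_mem_nhds (Ioo_mem_nhds (hK t ht') ht')]
    rw [hD, gradient_sub_const]
    exact (hsol (K t)).momentum t ⟨hK t ht', ht'⟩ x
  · intro t ht
    exact (hsol (K t)).divFree t ⟨hK t ht, ht⟩

end Exhaustion

/-- Arithmetic of the rescaled time: for `t ∈ (−(c^k)², 0)`, `(c^k)⁻² t ∈ (−1, 0)`. [folklore] -/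
private theorem inv_pow_sq_mul_mem_Ioo {c : ℝ} (hc : 0 < c) (k : ℕ) {t : ℝ}
    (ht : t ∈ Ioo (-(c ^ k) ^ 2) 0) : (c ^ k)⁻¹ ^ 2 * t ∈ Ioo (-1 : ℝ) 0 := by
  obtain ⟨h1, h2⟩ := ht
  have hck : 0 < (c ^ k) ^ 2 := by positivity
  rw [inv_pow]
  constructor
  · have h := div_lt_div_of_pos_right h1 hck
    rw [neg_div, div_self hck.ne'] at h
    rwa [inv_mul_eq_div]
  · exact mul_neg_of_pos_of_neg (inv_pos.2 hck) h2

/-- **Footnote 13 (backward extension of a classical RSS solution).** Let `(u, p)` be a classical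
solution of Navier–Stokes (`ν = 1`, `f = 0`) on the time set `[−1, 0)` whose velocity is the RSS
ansatz field `v` of (1.7) there, and assume `v` is `c`-DSS for some `c > 1` (Remark 1.5). Then `v`
(on all `t < 0`) is a classical solution on `(−∞, 0)` for some pressure: on `(−c^{2k}, 0)` it is
the Leray rescaling `(c^k)⁻¹ u((c^k)⁻² t, (c^k)⁻¹ x)` of `u` (`IsClassicalNSSolutionOn.nsRescale_holds`),
and the rescaled pressures patch after normalisation (`exists_pressure_Iio_of_Ioo`). [cite: PineauVicol2026, §2 footnote 13 (arXiv:2607.09619 p. 10)] -/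
theorem exists_isClassicalNSSolutionOn_Iio_of_rss
    {u v : ℝ → EuclideanSpace ℝ (Fin 3) → EuclideanSpace ℝ (Fin 3)}
    {p : ℝ → EuclideanSpace ℝ (Fin 3) → ℝ} {c : ℝ}
    (hsol : IsClassicalNSSolutionOn (Ico (-1) 0) 1 0 u p) (hc : 1 < c)
    (hdss : IsDiscretelySelfSimilar c v)
    (huv : ∀ t ∈ Ico (-1 : ℝ) 0, ∀ x : EuclideanSpace ℝ (Fin 3), u t x = v t x) :
    ∃ P : ℝ → EuclideanSpace ℝ (Fin 3) → ℝ, IsClassicalNSSolutionOn (Iio 0) 1 0 v P := by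
  have hc0 : 0 < c := zero_lt_one.trans hc
  have hpiece : ∀ k : ℕ,
      IsClassicalNSSolutionOn (Ioo (-(c ^ k) ^ 2) 0) 1 0 v
        (nsRescalePressure ((c ^ k)⁻¹) p) := by
    intro k
    have hd : 0 < (c ^ k)⁻¹ := inv_pos.2 (pow_pos hc0 k)
    have h1 := IsClassicalNSSolutionOn.nsRescale_holds hsol hd
    rw [nsRescaleForce_zero] at h1
    have h2 : IsClassicalNSSolutionOn (Ioo (-(c ^ k) ^ 2) 0) 1 0 (nsRescale (c ^ k)⁻¹ u)
        (nsRescalePressure (c ^ k)⁻¹ p) :=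
      h1.mono (fun t ht => Ioo_subset_Ico_self (inv_pow_sq_mul_mem_Ioo hc0 k ht))
        (uniqueDiffOn_Ioo _ _)
    refine isClassicalNSSolutionOn_congr_velocity h2 fun t ht => ?_
    funext x
    have hmem : (c ^ k)⁻¹ ^ 2 * t ∈ Ico (-1 : ℝ) 0 :=
      Ioo_subset_Ico_self (inv_pow_sq_mul_mem_Ioo hc0 k ht)
    have hk := congrFun (congrFun (hdss.inv_pow hc0.ne' k) t) x
    rw [nsRescale_apply] at hk
    rw [nsRescale_apply, huv _ hmem, hk]
  refine IsClassicalNSSolutionOn.exists_pressure_Iio_of_Ioo hpiece fun t ht => ?_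
  obtain ⟨n, hn⟩ := pow_unbounded_of_one_lt (-t) hc
  refine ⟨n, ?_⟩
  have h1 : (1 : ℝ) ≤ c ^ n := one_le_pow₀ hc.le
  have h2 : c ^ n ≤ (c ^ n) ^ 2 := by nlinarith
  linarith

/-! ### Remark 1.2: the profile bound gives the Type I bound of the ansatz field -/

/-- **Remark 1.2.** If `|U(y)| ≤ C₀/(|y| + 1)` then the RSS ansatz field obeys the Type I bound
`|u(x,t)| ≤ C₀/(|x| + √(−t))` for `t < 0` (rotations are isometries, `|y| = |x|/√(−t)`). [cite: PineauVicol2026, Remark 1.2 (arXiv:2607.09619 pp. 3–4)] -/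
theorem norm_pvAnsatz_le_of_profile {α C₀ : ℝ}
    {U : EuclideanSpace ℝ (Fin 3) → EuclideanSpace ℝ (Fin 3)}
    (hU : ∀ y : EuclideanSpace ℝ (Fin 3), ‖U y‖ ≤ C₀ / (‖y‖ + 1)) {t : ℝ} (ht : t < 0)
    (x : EuclideanSpace ℝ (Fin 3)) :
    ‖pvAnsatz α (fun y _ => U y) t x‖ ≤ C₀ / (‖x‖ + Real.sqrt (-t)) := by
  have hs : 0 < Real.sqrt (-t) := Real.sqrt_pos.2 (by linarith)
  simp only [pvAnsatz]
  rw [norm_smul, norm_inv, Real.norm_of_nonneg hs.le, norm_rotZ]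
  set y : EuclideanSpace ℝ (Fin 3) :=
    rotZ (-(α * -Real.log (-t))) ((Real.sqrt (-t))⁻¹ • x) with hy_def
  have hy : ‖y‖ = ‖x‖ / Real.sqrt (-t) := by
    rw [hy_def, norm_rotZ, norm_smul, norm_inv, Real.norm_of_nonneg hs.le, inv_mul_eq_div]
  calc (Real.sqrt (-t))⁻¹ * ‖U y‖ ≤ (Real.sqrt (-t))⁻¹ * (C₀ / (‖y‖ + 1)) :=
        mul_le_mul_of_nonneg_left (hU y) (inv_nonneg.2 hs.le)
    _ = C₀ / (‖x‖ + Real.sqrt (-t)) := by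
        rw [hy]
        field_simp

/-- For a field agreeing with the RSS ansatz on `[−1, 0)`, the Type I bound (1.10) at `t = −1`
is the profile bound (1.9) with the same constant (Remark 1.2: "the constants in (1.9) and
(1.10) are the same"; at `t = −1`, `s = 0`, `R(0) = Id`, `u(·,−1) = U`). [cite: PineauVicol2026, Remarks 1.2–1.3 (arXiv:2607.09619 p. 4)] -/
theorem profile_bound_of_typeI {α C₀ : ℝ}
    {u : ℝ → EuclideanSpace ℝ (Fin 3) → EuclideanSpace ℝ (Fin 3)}
    {U : EuclideanSpace ℝ (Fin 3) → EuclideanSpace ℝ (Fin 3)}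
    (hI : ∀ t ∈ Ico (-1 : ℝ) 0, ∀ x : EuclideanSpace ℝ (Fin 3),
      ‖u t x‖ ≤ C₀ / (‖x‖ + Real.sqrt (-t)))
    (hans : ∀ t ∈ Ico (-1 : ℝ) 0, ∀ x : EuclideanSpace ℝ (Fin 3),
      u t x = pvAnsatz α (fun y _ => U y) t x)
    (y : EuclideanSpace ℝ (Fin 3)) :
    ‖U y‖ ≤ C₀ / (‖y‖ + 1) := by
  have hmem : (-1 : ℝ) ∈ Ico (-1 : ℝ) 0 := ⟨le_rfl, by norm_num⟩
  have h1 := hI (-1) hmem y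
  rw [hans (-1) hmem y, pvAnsatz_neg_one] at h1
  simpa using h1

/-! ### Theorem 1.4, large `|α|`, from Chae–Wolf 2017 -/

/-- **Pineau–Vicol 2026, Theorem 1.4 — the case `|α| ≫ 1`, conditional on Chae–Wolf 2017,
Thm. 1.3** (the route the paper itself points out on p. 6: "[12] gives an alternative proof of the
large `|α|` case in Theorem 1.4"). Assume `chaeWolf2017_removing_dss`. Then for every `C₀ > 0`
there is `α₂ > 0` (namely `π / log λ_*(C₀)`) such that: if `(u, p)` is a classical Navier–Stokes
solution (`ν = 1`, `f = 0`) on `[−1, 0)` with the Type I bound `‖u(t,x)‖ ≤ C₀/(‖x‖ + √(−t))`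
and `u` is the RSS ansatz (1.7) with profile `U` and speed `α`, `|α| > α₂`, then `U ≡ 0`.
Proof: with `λ = e^{π/|α|} ∈ (1, λ_*)` the ansatz field is `λ`-DSS (Remark 1.5), extends to a
classical solution on `(−∞, 0)` (footnote 13) with the same Type I constant (Remark 1.2), so it
vanishes by Chae–Wolf; at `t = −1` it equals `U`. No regularity of `U` beyond the ansatz is used. [cite: PineauVicol2026, Theorem 1.4 and p. 6 (arXiv:2607.09619 pp. 4, 6)] -/
theorem pineauVicol2026_rss_liouville_large_of_chaeWolf (hCW : chaeWolf2017_removing_dss)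
    {C₀ : ℝ} (hC₀ : 0 < C₀) : ∃ α₂ : ℝ, 0 < α₂ ∧
      ∀ (α : ℝ) (u : ℝ → EuclideanSpace ℝ (Fin 3) → EuclideanSpace ℝ (Fin 3))
        (p : ℝ → EuclideanSpace ℝ (Fin 3) → ℝ)
        (U : EuclideanSpace ℝ (Fin 3) → EuclideanSpace ℝ (Fin 3)),
        IsClassicalNSSolutionOn (Ico (-1) 0) 1 0 u p →
        (∀ t ∈ Ico (-1 : ℝ) 0, ∀ x : EuclideanSpace ℝ (Fin 3),
          ‖u t x‖ ≤ C₀ / (‖x‖ + Real.sqrt (-t))) →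
        (∀ t ∈ Ico (-1 : ℝ) 0, ∀ x : EuclideanSpace ℝ (Fin 3),
          u t x = pvAnsatz α (fun y _ => U y) t x) →
        α₂ < |α| → U = 0 := by
  obtain ⟨c₁, hc₁, H⟩ := hCW C₀ hC₀
  have hlog₁ : 0 < Real.log c₁ := Real.log_pos hc₁
  refine ⟨Real.pi / Real.log c₁, div_pos Real.pi_pos hlog₁, ?_⟩
  intro α u p U hsol hI hans hα
  have hα0 : 0 < |α| := (div_pos Real.pi_pos hlog₁).trans hα
  have hαne : α ≠ 0 := abs_pos.1 hα0
  set c : ℝ := Real.exp (Real.pi / |α|) with hc_def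
  have hc1 : 1 < c := Real.one_lt_exp_iff.2 (div_pos Real.pi_pos hα0)
  have hcc₁ : c < c₁ := by
    rw [hc_def, ← Real.exp_log (zero_lt_one.trans hc₁), Real.exp_lt_exp, div_lt_iff₀ hα0]
    have h := (div_lt_iff₀ hlog₁).1 hα
    linarith [mul_comm (Real.log c₁) |α|]
  have hφ : ∀ (θ : ℝ) (v : EuclideanSpace ℝ (Fin 3)),
      rotZ (θ + α * (2 * Real.log c)) v = rotZ θ v :=
    fun θ v => rotZ_add_eq_self_of_exp_pi_div_abs hαne θ v
  have hdss : IsDiscretelySelfSimilar c (pvAnsatz α (fun y _ => U y)) :=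
    isDiscretelySelfSimilar_pvAnsatz (zero_lt_one.trans hc1) hφ U
  obtain ⟨P, hP⟩ := exists_isClassicalNSSolutionOn_Iio_of_rss hsol hc1 hdss hans
  have hU : ∀ y : EuclideanSpace ℝ (Fin 3), ‖U y‖ ≤ C₀ / (‖y‖ + 1) :=
    profile_bound_of_typeI hI hans
  have hIv : HasTypeIDecay C₀ (pvAnsatz α (fun y _ => U y)) :=
    fun t ht x => norm_pvAnsatz_le_of_profile hU ht x
  have hzero := H c hc1 hcc₁ _ P hP hdss hIv
  funext y
  have h := hzero (-1) (by norm_num) y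
  rwa [pvAnsatz_neg_one] at h

/-- **Assembly of Theorem 1.4 from its two halves.** `pineauVicol2026_rss_liouville` follows from
Chae–Wolf 2017, Thm. 1.3 (`chaeWolf2017_removing_dss`, giving the half `|α| ≫ 1` by
`pineauVicol2026_rss_liouville_large_of_chaeWolf`) together with the small-`|α|` half — the
paper's §5 (weighted-`L²` enstrophy estimate with the adjoint-kernel weight of Prop. 5.1), which
is the genuinely new part of the paper and is NOT proved here; it enters as the explicit
hypothesis `hsmall`, stated in the rendering of `PineauVicolRSS.lean`. (Bookkeeping only.) [cite: PineauVicol2026, Theorem 1.4 (arXiv:2607.09619 p. 4)] -/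
theorem pineauVicol2026_rss_liouville_of_chaeWolf_of_small (hCW : chaeWolf2017_removing_dss)
    (hsmall : ∀ C₀ : ℝ, 0 < C₀ → ∃ α₁ : ℝ, 0 < α₁ ∧
      ∀ (α : ℝ) (u : ℝ → EuclideanSpace ℝ (Fin 3) → EuclideanSpace ℝ (Fin 3))
        (p : ℝ → EuclideanSpace ℝ (Fin 3) → ℝ)
        (U : EuclideanSpace ℝ (Fin 3) → EuclideanSpace ℝ (Fin 3)),
        IsClassicalNSSolutionOn (Ico (-1) 0) 1 0 u p →
        (∀ t ∈ Ico (-1 : ℝ) 0, ∀ x : EuclideanSpace ℝ (Fin 3),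
          ‖u t x‖ ≤ C₀ / (‖x‖ + Real.sqrt (-t))) →
        ContDiff ℝ 2 U →
        (∀ t ∈ Ico (-1 : ℝ) 0, ∀ x : EuclideanSpace ℝ (Fin 3),
          u t x = pvAnsatz α (fun y _ => U y) t x) →
        |α| < α₁ → U = 0) :
    pineauVicol2026_rss_liouville := by
  intro C₀ hC₀
  obtain ⟨α₁, hα₁, h₁⟩ := hsmall C₀ hC₀
  obtain ⟨α₂, hα₂, h₂⟩ := pineauVicol2026_rss_liouville_large_of_chaeWolf hCW hC₀
  refine ⟨α₁, α₂, hα₁, hα₂, fun α u p U hsol hI hU hans hα => ?_⟩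
  rcases hα with hlt | hgt
  · exact h₁ α u p U hsol hI hU hans hlt
  · exact h₂ α u p U hsol hI hans hgt

end Literature.Analysis.FluidPDE

end
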